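import Mathlib
import Summits.MatrixMultiplication.MatrixMultiplication.Theses.FourierTwoFamiliesModP
import Summits.MatrixMultiplication.MatrixMultiplication.Theorems.FourierTwoFamiliesModPPrimeTwoFamiliesStubWords
import Summits.MatrixMultiplication.MatrixMultiplication.Theorems.FourierTwoFamiliesModPPrimeTwoFamiliesLadderConverse
import Summits.MatrixMultiplication.MatrixMultiplication.Theorems.FourierTwoFamiliesModPPrimeTwoFamiliesCapacityEquivalences

/-!
# Ladders are capacity gadgets; `PrimeTwoFamilies ↔` the cyclic ladder conjecture, assembled
# through the capacity form (crux stmt-MatrixMultiplication-14308, registered stub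
# `primeTwoFamilies_iff_cyclicLadder`)

Crux `FourierTwoFamiliesModP.PrimeTwoFamilies` (CKSU 2005 Conj. 4.7 with prime cyclic hosts) has two
landed equivalent finitary forms in `ℤ/m`:

* the CYCLIC LADDER form (`LadderLift.cyclicLadder_of_primeTwoFamilies`, file
  `…PrimeTwoFamiliesLadderConverse`): `r ≥ m^{1/2-ε}` classes `(X c, Y c)` with (i) every class direct
  and (ii) for classes `p < q` every lower cross difference `y' - x'` (`x' ∈ X p`, `y' ∈ Y q`) avoiding
  every diagonal difference `y - x` (`x ∈ X c`, `y ∈ Y c`), of co-volume `|X c||Y c| ≥ m^{1-ε}`;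
* the CAPACITY-GADGET form (`CapacityLift.capacityGadgets_iff_primeTwoFamilies`, file
  `…PrimeTwoFamiliesCapacityEquivalences`): direct pairs `(P c, Q c)_{c<r}` of co-volume `≥ m^{1-ε}`
  and a zero-error code `W` of words `Fin L → Fin r` (`L ≥ 1`, every ordered pair of distinct words
  strongly separated in some coordinate) with `|W| ≥ (m^L)^{1/2-ε}`.

This file proves the DIRECT bridge between the two forms, without passing through the crux:
`capacityGadgets_of_cyclicLadder` — a ladder IS a capacity gadget, its code being the words of one
fixed digit sum (two distinct words of equal digit sum differ upwards in some coordinate `t`,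
`i t < k t`, and there clause (ii) is exactly strong separation; the pigeonhole `LadderLift.stub_words`
gives `|W| ≥ r^L / (L r + 1)`, and the word length `L = ⌈2/ε⌉₊` makes this `≥ (m^L)^{1/2-ε}` for large
`m`, lemma `words_bookkeeping`).  Assembling with the two landed forms gives a second, independent
kernel path to the registered stub `primeTwoFamilies_iff_cyclicLadder` of the crux (the first is
`LadderLift.primeTwoFamilies_iff_cyclicLadder`, through `stub_lift`/`stub_bookkeeping`): (⇒)
`LadderLift.cyclicLadder_of_primeTwoFamilies`; (⇐) `capacityGadgets_of_cyclicLadder` then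
`CapacityLift.capacityGadgets_iff_primeTwoFamilies`.
-/

-- single-conjunct summit: the mandated namespace repeats `MatrixMultiplication` (summit = sub-problem).
set_option linter.dupNamespace false

namespace Summit.MatrixMultiplication.MatrixMultiplication.Theorems.PrimeTwoFamilies.LadderViaCapacity

open Finset
open Summit.MatrixMultiplication.MatrixMultiplication.Theses

-- adapted from Summits/MatrixMultiplication/MatrixMultiplication/Theorems/
--   FourierTwoFamiliesModPPrimeTwoFamiliesStubBookkeeping.lean (`LadderLift.eventually_dominates`, private there)
/-- A constant multiple of a smaller real power of `m` is eventually dominated by a larger power: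
if `0 < K` and `a < b` then `K * m ^ a ≤ m ^ b` for all naturals `m ≥ ⌈K ^ (1/(b-a))⌉₊ + 1`. -/
private theorem eventually_dominates (K a b : ℝ) (hK : 0 < K) (hab : a < b) :
    ∃ m₀ : ℕ, ∀ m : ℕ, m₀ ≤ m → K * (m : ℝ) ^ a ≤ (m : ℝ) ^ b := by
  have hc : 0 < b - a := sub_pos.mpr hab
  refine ⟨⌈K ^ (b - a)⁻¹⌉₊ + 1, fun m hm => ?_⟩
  have hm1 : ((⌈K ^ (b - a)⁻¹⌉₊ + 1 : ℕ) : ℝ) ≤ m := by exact_mod_cast hm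
  push_cast at hm1
  have hceil : K ^ (b - a)⁻¹ ≤ (⌈K ^ (b - a)⁻¹⌉₊ : ℝ) := Nat.le_ceil _
  have hT0 : (0 : ℝ) ≤ K ^ (b - a)⁻¹ := Real.rpow_nonneg hK.le _
  have hKm' : K ^ (b - a)⁻¹ ≤ (m : ℝ) := by linarith
  have hm0 : (0 : ℝ) < m := by linarith
  have hKm : K ≤ (m : ℝ) ^ (b - a) := by
    calc K = (K ^ (b - a)⁻¹) ^ (b - a) := (Real.rpow_inv_rpow hK.le hc.ne').symm
      _ ≤ (m : ℝ) ^ (b - a) := Real.rpow_le_rpow hT0 hKm' hc.le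
  calc K * (m : ℝ) ^ a ≤ (m : ℝ) ^ (b - a) * (m : ℝ) ^ a :=
        mul_le_mul_of_nonneg_right hKm (Real.rpow_nonneg hm0.le _)
    _ = (m : ℝ) ^ b := by rw [← Real.rpow_add hm0, sub_add_cancel]

-- adapted from …StubLift.lean (`LadderLift.exists_lt_of_sum_eq_of_ne`, private there)
/-- Two words `i k : Fin L → Fin r` of equal digit sum with `i ≠ k` differ upwards somewhere:
there is a coordinate `t` with `i t < k t`. -/
private lemma exists_lt_of_sum_eq_of_ne {L r : ℕ} {i k : Fin L → Fin r}
    (hsum : ∑ t, ((i t : ℕ)) = ∑ t, ((k t : ℕ))) (hik : i ≠ k) : ∃ t, i t < k t := by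
  by_contra hex
  have hle : ∀ t ∈ (Finset.univ : Finset (Fin L)), ((k t : ℕ)) ≤ ((i t : ℕ)) :=
    fun t _ => Fin.le_def.1 (not_lt.1 fun h => hex ⟨t, h⟩)
  have heq := (Finset.sum_eq_sum_iff_of_le hle).1 hsum.symm
  exact hik (funext fun t => Fin.ext ((heq t (Finset.mem_univ t)).symm))

/-- The counting step in `ℕ`: if `1 ≤ r`, `1 ≤ L` and `r ^ L ≤ (L r + 1) N` then
`r ^ (L - 1) ≤ (L + 1) N` (bound the `+ 1` by `r` and cancel one factor `r`). -/
private theorem pow_pred_le_mul_of_words (r L N : ℕ) (hr : 1 ≤ r) (hL : 1 ≤ L)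
    (h : r ^ L ≤ (L * r + 1) * N) : r ^ (L - 1) ≤ (L + 1) * N := by
  obtain ⟨L', rfl⟩ : ∃ L', L = L' + 1 := ⟨L - 1, by omega⟩
  rw [Nat.add_sub_cancel]
  have h2 : r ^ L' * r ≤ (L' + 1 + 1) * N * r := by
    calc r ^ L' * r = r ^ (L' + 1) := (pow_succ r L').symm
      _ ≤ ((L' + 1) * r + 1) * N := h
      _ ≤ ((L' + 1) * r + r) * N := Nat.mul_le_mul_right N (Nat.add_le_add_left hr _)
      _ = (L' + 1 + 1) * N * r := by ring
  exact Nat.le_of_mul_le_mul_right h2 hr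

/-- **Word-length bookkeeping.**  For `ε > 0` put `L := ⌈2/ε⌉₊` (`L ≥ 1`, `L ε ≥ 2`).  Then for all
large `m`, every `r ≥ m^{1/2-ε/2}` and every `N` with `r ^ L ≤ (L r + 1) N` (the pigeonhole count of
the most popular digit sum, `LadderLift.stub_words`) satisfy `(m^L)^{1/2-ε} ≤ N`: indeed
`(L+1) N ≥ r^{L-1} ≥ m^{(1/2-ε/2)(L-1)} ≥ (L+1) m^{L(1/2-ε)}`, the last exponent gap being
`(ε (L+1) - 1)/2 > 0`. -/
theorem words_bookkeeping (ε : ℝ) (hε : 0 < ε) :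
    ∃ L : ℕ, 1 ≤ L ∧ ∃ m₁ : ℕ, ∀ m : ℕ, m₁ ≤ m → ∀ r : ℕ, (m : ℝ) ^ (1 / 2 - ε / 2) ≤ (r : ℝ) →
      ∀ N : ℕ, r ^ L ≤ (L * r + 1) * N → ((m : ℝ) ^ (L : ℝ)) ^ (1 / 2 - ε) ≤ (N : ℝ) := by
  obtain ⟨L, hL, hLε⟩ : ∃ L : ℕ, 1 ≤ L ∧ 2 ≤ (L : ℝ) * ε := by
    refine ⟨⌈2 / ε⌉₊, Nat.ceil_pos.2 (by positivity), ?_⟩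
    have h := Nat.le_ceil (2 / ε)
    rwa [div_le_iff₀ hε] at h
  have hL1R : ((L - 1 : ℕ) : ℝ) = (L : ℝ) - 1 := by rw [Nat.cast_sub hL, Nat.cast_one]
  have hgap : (L : ℝ) * (1 / 2 - ε) < (1 / 2 - ε / 2) * ((L - 1 : ℕ) : ℝ) := by
    rw [hL1R]
    nlinarith
  obtain ⟨m₁, hm₁⟩ := eventually_dominates ((L : ℝ) + 1) _ _ (by positivity) hgap
  refine ⟨L, hL, max m₁ 1, fun m hm r hr N hN => ?_⟩
  have hmm₁ : m₁ ≤ m := le_trans (le_max_left _ _) hm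
  have hm1 : 1 ≤ m := le_trans (le_max_right _ _) hm
  have hm1R : (1 : ℝ) ≤ m := by exact_mod_cast hm1
  have hm0R : (0 : ℝ) ≤ m := zero_le_one.trans hm1R
  have hmpos : (0 : ℝ) < m := zero_lt_one.trans_le hm1R
  -- `r ≥ 1`
  have hrpos : (0 : ℝ) < r := lt_of_lt_of_le (Real.rpow_pos_of_pos hmpos _) hr
  have hr1 : 1 ≤ r := Nat.cast_pos.1 hrpos
  -- the counting step, cast to `ℝ`
  have hNat : r ^ (L - 1) ≤ (L + 1) * N := pow_pred_le_mul_of_words r L N hr1 hL hN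
  have hR : (r : ℝ) ^ (L - 1) ≤ ((L : ℝ) + 1) * N := by exact_mod_cast hNat
  have hpow : ((m : ℝ) ^ (1 / 2 - ε / 2)) ^ (L - 1) ≤ (r : ℝ) ^ (L - 1) :=
    pow_le_pow_left₀ (Real.rpow_nonneg hm0R _) hr (L - 1)
  have key : ((L : ℝ) + 1) * ((m : ℝ) ^ (L : ℝ)) ^ (1 / 2 - ε) ≤ ((L : ℝ) + 1) * N := by
    calc ((L : ℝ) + 1) * ((m : ℝ) ^ (L : ℝ)) ^ (1 / 2 - ε)
        = ((L : ℝ) + 1) * (m : ℝ) ^ ((L : ℝ) * (1 / 2 - ε)) := by rw [← Real.rpow_mul hm0R]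
      _ ≤ (m : ℝ) ^ ((1 / 2 - ε / 2) * ((L - 1 : ℕ) : ℝ)) := hm₁ m hmm₁
      _ = ((m : ℝ) ^ (1 / 2 - ε / 2)) ^ (L - 1) := Real.rpow_mul_natCast hm0R _ _
      _ ≤ (r : ℝ) ^ (L - 1) := hpow
      _ ≤ ((L : ℝ) + 1) * N := hR
  exact le_of_mul_le_mul_left key (by positivity)

/-- **Ladders are capacity gadgets.**  If for every `ε > 0` there are arbitrarily large `m` and
ordered escape ladders `(X c, Y c)_{c<r}` in `ZMod m` ((i) every class direct; (ii) for `p < q` every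
lower cross difference `y' - x'`, `x' ∈ X p`, `y' ∈ Y q`, differs from every diagonal difference
`y - x`, `x ∈ X c`, `y ∈ Y c`) with `m^{1/2-ε} ≤ r` and co-volumes `m^{1-ε} ≤ |X c||Y c|`, then for
every `ε > 0` there are arbitrarily large `m` and capacity gadgets: the same direct pairs
`P = X`, `Q = Y` together with the zero-error code `W` of all words `Fin L → Fin r` of the most
popular digit sum, `L = ⌈2/ε⌉₊ ≥ 1`, `|W| ≥ (m^L)^{1/2-ε}`.  Separation: distinct words of equal
digit sum have a coordinate `t` with `i t < k t` (`exists_lt_of_sum_eq_of_ne`), where (ii) at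
`(c, i t, k t)` says `q - p ≠ q' - p'` for `p ∈ X (i t)`, `q ∈ Y (k t)`, `p' ∈ X c`, `q' ∈ Y c`. -/
theorem capacityGadgets_of_cyclicLadder
    (hC : ∀ ε : ℝ, 0 < ε → ∀ m₀ : ℕ, ∃ m ≥ m₀, ∃ r : ℕ, ∃ X Y : Fin r → Finset (ZMod m),
      ((∀ c : Fin r, ∀ x ∈ X c, ∀ x' ∈ X c, ∀ y ∈ Y c, ∀ y' ∈ Y c,
          (x - x') + (y - y') = 0 → x = x' ∧ y = y') ∧
        (∀ c p q : Fin r, p < q → ∀ x ∈ X c, ∀ y ∈ Y c, ∀ x' ∈ X p, ∀ y' ∈ Y q,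
          y - x ≠ y' - x')) ∧
      (m : ℝ) ^ (1 / 2 - ε) ≤ (r : ℝ) ∧
      ∀ c : Fin r, (m : ℝ) ^ (1 - ε) ≤ (((X c).card * (Y c).card : ℕ) : ℝ)) :
    ∀ ε : ℝ, 0 < ε → ∀ m₀ : ℕ, ∃ m ≥ m₀, ∃ r L : ℕ, ∃ P Q : Fin r → Finset (ZMod m),
      ∃ W : Finset (Fin L → Fin r),
      (∀ c : Fin r, ∀ x ∈ P c, ∀ x' ∈ P c, ∀ y ∈ Q c, ∀ y' ∈ Q c,
          (x - x') + (y - y') = 0 → x = x' ∧ y = y') ∧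
      (∀ i ∈ W, ∀ k ∈ W, i ≠ k → ∃ t : Fin L,
        ∀ p ∈ P (i t), ∀ q ∈ Q (k t), ∀ c : Fin r, ∀ p' ∈ P c, ∀ q' ∈ Q c, q - p ≠ q' - p') ∧
      1 ≤ L ∧
      ((m : ℝ) ^ (L : ℝ)) ^ (1 / 2 - ε) ≤ (W.card : ℝ) ∧
      ∀ c : Fin r, (m : ℝ) ^ (1 - ε) ≤ (((P c).card * (Q c).card : ℕ) : ℝ) := by
  intro ε hε m₀
  obtain ⟨L, hL, m₁, hm₁⟩ := words_bookkeeping ε hε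
  obtain ⟨m, hm, r, X, Y, ⟨hW, hLad⟩, hr, hcov⟩ := hC (ε / 2) (half_pos hε) (max m₀ (max m₁ 1))
  have hm₀ : m₀ ≤ m := le_trans (le_max_left _ _) hm
  have hmm₁ : m₁ ≤ m := le_trans (le_trans (le_max_left _ _) (le_max_right _ _)) hm
  have hm1 : 1 ≤ m := le_trans (le_trans (le_max_right _ _) (le_max_right _ _)) hm
  have hm1R : (1 : ℝ) ≤ m := by exact_mod_cast hm1
  obtain ⟨S, hS⟩ := LadderLift.stub_words r L
  refine ⟨m, hm₀, r, L, X, Y,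
    Finset.univ.filter (fun w : Fin L → Fin r => ∑ t, ((w t : ℕ)) = S), hW, ?_, hL, ?_, ?_⟩
  · -- the constant-sum words are a zero-error code over the ladder
    intro i hi k hk hik
    rw [Finset.mem_filter] at hi hk
    obtain ⟨t, ht⟩ := exists_lt_of_sum_eq_of_ne (hi.2.trans hk.2.symm) hik
    refine ⟨t, fun p hp q hq c p' hp' q' hq' h => ?_⟩
    exact hLad c (i t) (k t) ht p' hp' q' hq' p hp q hq h.symm
  · -- the code is large: `(m^L)^{1/2-ε} ≤ |W|`
    exact hm₁ m hmm₁ r hr _ hS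
  · -- co-volumes: `m^{1-ε} ≤ m^{1-ε/2} ≤ |X c||Y c|`
    intro c
    exact le_trans (Real.rpow_le_rpow_of_exponent_le hm1R (by linarith)) (hcov c)

/-- **`PrimeTwoFamilies ↔` the cyclic ladder conjecture** (registered stub
`primeTwoFamilies_iff_cyclicLadder` of crux stmt-MatrixMultiplication-14308, assembled from landed
lemmas of the crux through the capacity form): CKSU Conj. 4.7 with prime cyclic hosts holds iff for
every `ε > 0` there are arbitrarily large `m` and ordered escape ladders in `ZMod m` — (i) every class
direct, (ii) lower cross differences (`p < q`) avoiding all diagonal differences — with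
`m^{1/2-ε} ≤ r` classes of co-volume `m^{1-ε} ≤ |X c||Y c|`.
(⇒) `LadderLift.cyclicLadder_of_primeTwoFamilies` (an SDPP witness is a ladder in any order);
(⇐) ladders are capacity gadgets (`capacityGadgets_of_cyclicLadder`) and capacity gadgets give the
crux (`CapacityLift.capacityGadgets_iff_primeTwoFamilies`: code lift, carry-free transfer into a
Bertrand prime, exponent bookkeeping). -/
theorem primeTwoFamilies_iff_cyclicLadder :
    FourierTwoFamiliesModP.PrimeTwoFamilies ↔
    (∀ ε : ℝ, 0 < ε → ∀ m₀ : ℕ, ∃ m ≥ m₀, ∃ r : ℕ, ∃ X Y : Fin r → Finset (ZMod m),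
      ((∀ c : Fin r, ∀ x ∈ X c, ∀ x' ∈ X c, ∀ y ∈ Y c, ∀ y' ∈ Y c,
          (x - x') + (y - y') = 0 → x = x' ∧ y = y') ∧
        (∀ c p q : Fin r, p < q → ∀ x ∈ X c, ∀ y ∈ Y c, ∀ x' ∈ X p, ∀ y' ∈ Y q,
          y - x ≠ y' - x')) ∧
      (m : ℝ) ^ (1 / 2 - ε) ≤ (r : ℝ) ∧
      ∀ c : Fin r, (m : ℝ) ^ (1 - ε) ≤ (((X c).card * (Y c).card : ℕ) : ℝ)) :=
  ⟨LadderLift.cyclicLadder_of_primeTwoFamilies, fun hC =>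
    CapacityLift.capacityGadgets_iff_primeTwoFamilies.1 (capacityGadgets_of_cyclicLadder hC)⟩

end Summit.MatrixMultiplication.MatrixMultiplication.Theorems.PrimeTwoFamilies.LadderViaCapacity
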